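/-
Copyright (c) 2026 the pub-hodgecm-mathlib formalisation cell (harness21).  Prover seat hodgecm-mathlib-F0P3a-p03 (g8), topic T5 = P8
«(C♯)hol interior», row «Cc (3′)» brick β-II (second hand of A-p19 (g19), desk F0P2-plan (g8) ∕ lead B-p18 (g29)), 2026-08-31.
KERNEL module: THEOREMS ONLY (no definition, no named fact, no `sorry`, no instance, no notation).
-/
import Literature.NumberTheory.GelbartRogawski1991.DoubledWeilRepresentationArchVacuumUndoubling
import Literature.NumberTheory.Weil1964.ArchFollandHermiteReindex
import Literature.NumberTheory.Weil1964.ArchPlaceCompactSliceCharacter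
import HarnessLib

/-!
# The doubled Folland frame on the HERMITE BASIS: `frameD`-coordinates of `R_{e₂}(h^V_{β₁} ⊠ h^V_{β₂})` (β-II of node Cc)

Topic `NumberTheory/GelbartRogawski1991`; namespace `Literature.NumberTheory.GelbartRogawski1991.GRConstruction` (that of ★
`DoubledWeilRepresentationArchVacuum(Undoubling)`, whose frames `frameD` (doubled space `𝕎 ⊕ 𝕎⁻`) and `frameV` (one copy) and
Gaussians this file continues).  KERNEL: theorems only.  Cell hodgecm-mathlib FLOOR 0, programme P2, topic T5 = P8 «(C♯)hol interior»,
node Cc (3′), brick β-II of A-p19 (g19)'s architecture (`F0/P2/A-p19/g19/cc/ROAD-Cc-3prime.A-p19g19.md`; bus 2026-08-31T21:51:53Z,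
22:12:13Z): the `β = 0 ↦ β` generalisation of ★ `schwartzReindexCLM_archBoxTensor_gaussianV`.

* §1 **`schwartzTransport_frameD_archBoxTensor_follandHermite`**: in the coordinates of the doubled frame `frameD`, the re-enumerated
  box tensor `R_{e₂}(h^V_{β₁} ⊠ h^V_{β₂})` of two Folland–Hermite functions of ONE copy (`h^V_β := follandHermite frameV β`) IS the
  Hermite function `h_γ` of `𝓢(ℝ^{(n+n) × places})` with the juxtaposed index `γ = (β₁ ⊔ β₂) ∘ (e₂ × 1)⁻¹` — because the scale of
  `frameD` on both copies is that of `frameV` (`√|±x_v(j)| = √|x_v(j)|`, ★ `signVec_doubled_inl/inr`) and Hermite functions of a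
  juxtaposed frame are products (★ `archBoxTensor_follandHermite_sumIdx_eq`, ★ `schwartzReindexCLM_follandHermite_scaledFrame`).
* §2 `zeta_doubledIdx`: the Fock symbol of the juxtaposed index factors over the two copies.
* §3 `schwartzTransport_frameD_archBoxTensor_binvPi`: §1 extended by linearity to `B⁻¹P` in the first slot (`P` any Fock polynomial).
* §4 `placeMap_linSubst_doubled_comp_rename_inl/_inr`: the Bargmann substitution of `((W ⊕ 1)^{e₂} at v₀)⁻¹` is `(W at v₀)⁻¹` on the
  first copy and the identity on the second.
* §5 **`unitaryOpPi_placeBlock_mulSingle_doubled_schwartzTransport_frameD`** and its `carrierConjEquiv` form: the metaplectic operator of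
  `(W ⊕ 1)^{e₂}` at ONE place `v₀` acts on `frameD^* R_{e₂}(h^V_{β₁} ⊠ h^V_{β₂})` through `μ₀(W at v₀)` on the first factor — the operator
  transport the Cc closer's `hS` needs on the Hermite basis (★ `unitaryOpPi_binvPi`, ★ `linSubst_blockDiagonal_mulSingle`).

HONEST SCOPE.  Frame bookkeeping in the Schwartz/Fock model ([Folland1989, §1.7]); nothing of [Liu2021] or [GelbartRogawski1991] is
asserted.  HC_CM is proved only modulo the printed citations until rung 0 closes; this file books nothing and discharges nothing booked.

## References
* [Folland1989] G. B. Folland, *Harmonic Analysis in Phase Space*, Princeton UP (1989), §1.3 (1.25), §1.7 (1.81), §4.2 Prop. (4.39).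
* [HarrisKudlaSweet1996] M. Harris, S. Kudla, W. Sweet, J. AMS 9 (1996), §1 (1.9) (the doubled space `𝕍 ⊕ (−𝕍)`).
-/

set_option autoImplicit false

noncomputable section

open scoped Classical
open scoped Matrix Kronecker TensorProduct SchwartzMap
open NumberField NumberField.InfinitePlace NumberField.mixedEmbedding IsDedekindDomain
open Literature.RepresentationTheory.HeisenbergGroup
open Literature.NumberTheory.Automorphic
open Literature.NumberTheory.Weil1964
open Literature.RepresentationTheory.HarrisKudlaSweet1996
open Literature.NumberTheory.GaloisRepresentations
open Literature.Analysis.SegalBargmann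

namespace Literature.NumberTheory.GelbartRogawski1991.GRConstruction

open UnitaryDualPair UnitaryDualPair.ArchSplitting
open Literature.NumberTheory.GelbartRogawski1991.UnitaryDualPair.LocalSplitting
open Literature.RepresentationTheory Literature.RepresentationTheory.KonnoKonno2007 MvPolynomial

variable (L : Type) [Field L] [NumberField L] [IsCMField L]

variable {N M n : ℕ} (e : Fin N × Fin M ≃ Fin n)
  (dV : Fin N → L) (hdV : ∀ i, IsCMField.complexConj L (dV i) = dV i) (hdV0 : ∀ i, dV i ≠ 0)
  (dW : Fin M → L) (hdW : ∀ i, IsCMField.complexConj L (dW i) = dW i) (hdW0 : ∀ i, dW i ≠ 0)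

/-! ## §1 The doubled frame on the Hermite basis -/

/-- two scaled frames with the same scale function are equal (proof irrelevance for the non-vanishing witness). [folklore] -/
private theorem scaledFrame_congr {F : Type} [Field F] [NumberField F] [IsTotallyReal F] {ι : Type} [Fintype ι] [DecidableEq ι]
    {D₁ D₂ : ι × {v : InfinitePlace F // v.IsReal} → ℝ} (h₁ : ∀ k, D₁ k ≠ 0) (h₂ : ∀ k, D₂ k ≠ 0) (h : D₁ = D₂) :
    scaledFrame F ι D₁ h₁ = scaledFrame F ι D₂ h₂ := by
  subst h
  rfl

/-- **THE DOUBLED FRAME ON THE HERMITE BASIS**: `frameD^* (R_{e₂}(h^V_{β₁} ⊠ h^V_{β₂})) = h_γ` with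
`γ = ((β₁ ⊔ β₂) ∘ sumProdDistrib) ∘ (e₂ × 1)⁻¹` — the `β = 0 ↦ β` generalisation of ★ `schwartzReindexCLM_archBoxTensor_gaussianV`
(`h^V_β = follandHermite frameV β`; the scale of `frameD` is `√|x_v(j)|` on BOTH copies). [cite: Folland1989, §1.7 (1.81), §1.3 (1.25)]
[cite: HarrisKudlaSweet1996, §1 (1.9)] -/
theorem schwartzTransport_frameD_archBoxTensor_follandHermite
    (β₁ β₂ : (Fin n × {v : InfinitePlace (Fp L) // v.IsReal}) →₀ ℕ) :
    schwartzTransport (frameD L e dV hdV hdV0 dW hdW hdW0)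
        (schwartzReindexCLM (Fp L) (e₂ (n := n))
          (archBoxTensor (follandHermite (frameV L e dV hdV hdV0 dW hdW hdW0) β₁)
            (follandHermite (frameV L e dV hdV hdV0 dW hdW hdW0) β₂))) =
      hermitePi (((sumIdx β₁ β₂).equivMapDomain
          (Equiv.sumProdDistrib (Fin n) (Fin n) {v : InfinitePlace (Fp L) // v.IsReal}).symm).equivMapDomain
        ((e₂ (n := n)).prodCongr (Equiv.refl {v : InfinitePlace (Fp L) // v.IsReal}))) := by
  -- the scale of one copy and its non-vanishing
  have hDV : ∀ k : Fin n × {v : InfinitePlace (Fp L) // v.IsReal},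
      placeScale n (fun v => sqrtAbs (signVec (cmPlaceOver L) (cmGramEntry L e dV hdV dW hdW) (imagUnit L) v)) k ≠ 0 :=
    placeScale_ne_zero n (sqrtAbs_signVec_ne_zero (IsCMField.complexConj_ne_one L) (cmPlaceOver_smul L)
      (complexConj_imagUnit L) (imagUnit_ne_zero L) (cmGramEntry_ne_zero L e dV hdV dW hdW hdV0 hdW0))
  have hDsum : ∀ k : (Fin n ⊕ Fin n) × {v : InfinitePlace (Fp L) // v.IsReal},
      Sum.elim
        (fun i => placeScale n (fun v => sqrtAbs (signVec (cmPlaceOver L) (cmGramEntry L e dV hdV dW hdW) (imagUnit L) v)) (i, k.2))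
        (fun j => placeScale n (fun v => sqrtAbs (signVec (cmPlaceOver L) (cmGramEntry L e dV hdV dW hdW) (imagUnit L) v)) (j, k.2))
        k.1 ≠ 0 := by
    rintro ⟨s, v⟩
    rcases s with i | i
    · exact hDV (i, v)
    · exact hDV (i, v)
  have h1 : archBoxTensor (follandHermite (frameV L e dV hdV hdV0 dW hdW hdW0) β₁) (follandHermite (frameV L e dV hdV hdV0 dW hdW hdW0) β₂) =
      follandHermite (scaledFrame (Fp L) (Fin n ⊕ Fin n)
        (fun k : (Fin n ⊕ Fin n) × {v : InfinitePlace (Fp L) // v.IsReal} =>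
          Sum.elim
            (fun i => placeScale n (fun v => sqrtAbs (signVec (cmPlaceOver L) (cmGramEntry L e dV hdV dW hdW) (imagUnit L) v)) (i, k.2))
            (fun j => placeScale n (fun v => sqrtAbs (signVec (cmPlaceOver L) (cmGramEntry L e dV hdV dW hdW) (imagUnit L) v)) (j, k.2))
            k.1) hDsum)
        ((sumIdx β₁ β₂).equivMapDomain (Equiv.sumProdDistrib (Fin n) (Fin n) {v : InfinitePlace (Fp L) // v.IsReal}).symm) :=
    archBoxTensor_follandHermite_sumIdx_eq _ hDV _ hDV hDsum β₁ β₂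
  rw [h1]
  refine (congrArg (schwartzTransport (frameD L e dV hdV hdV0 dW hdW hdW0))
    (schwartzReindexCLM_follandHermite_scaledFrame (e₂ (n := n)) _ hDsum _)).trans ?_
  -- the reindexed juxtaposed frame IS `frameD` (same scales on both copies)
  have hframe : scaledFrame (Fp L) (Fin (n + n))
      (fun k : Fin (n + n) × {v : InfinitePlace (Fp L) // v.IsReal} =>
        Sum.elim
          (fun i => placeScale n (fun v => sqrtAbs (signVec (cmPlaceOver L) (cmGramEntry L e dV hdV dW hdW) (imagUnit L) v)) (i, k.2))
          (fun j => placeScale n (fun v => sqrtAbs (signVec (cmPlaceOver L) (cmGramEntry L e dV hdV dW hdW) (imagUnit L) v)) (j, k.2))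
          ((e₂ (n := n)).symm k.1))
      (fun k => hDsum ((e₂ (n := n)).symm k.1, k.2)) = frameD L e dV hdV hdV0 dW hdW hdW0 := by
    refine scaledFrame_congr _ _ (funext fun k => ?_)
    obtain ⟨j, v⟩ := k
    obtain ⟨s, rfl⟩ := (e₂ (n := n)).surjective j
    rcases s with i | i
    · simp only [Equiv.symm_apply_apply, Sum.elim_inl, placeScale, sqrtAbs, signVec_doubled_inl]
    · simp only [Equiv.symm_apply_apply, Sum.elim_inr, placeScale, sqrtAbs, signVec_doubled_inr, abs_neg]
  rw [← schwartzTransport_follandHermite (frameD L e dV hdV hdV0 dW hdW hdW0)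
    ((((sumIdx β₁ β₂).equivMapDomain (Equiv.sumProdDistrib (Fin n) (Fin n) {v : InfinitePlace (Fp L) // v.IsReal}).symm).equivMapDomain
      ((e₂ (n := n)).prodCongr (Equiv.refl {v : InfinitePlace (Fp L) // v.IsReal}))))]
  congr 2

/-! ## §2 The symbol algebra of the two copies: `ζ_γ = ζ_{β₁}(first copy) · ζ_{β₂}(second copy)` -/

omit [NumberField L] [IsCMField L] in
/-- the juxtaposition equivalence composed with `inl` is the first-copy embedding `(i, v) ↦ (e₂ (inl i), v)`. [folklore] -/
private theorem sumProdDistrib_symm_trans_inl (k : Fin n × {v : InfinitePlace (Fp L) // v.IsReal}) :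
    ((Equiv.sumProdDistrib (Fin n) (Fin n) {v : InfinitePlace (Fp L) // v.IsReal}).symm.trans
        ((e₂ (n := n)).prodCongr (Equiv.refl {v : InfinitePlace (Fp L) // v.IsReal}))) (Sum.inl k) =
      ((e₂ (n := n)) (Sum.inl k.1), k.2) := by
  obtain ⟨i, v⟩ := k
  simp only [Equiv.trans_apply, Equiv.sumProdDistrib_symm_apply_left, Equiv.prodCongr_apply, Prod.map_apply,
    Equiv.coe_refl, id_eq]

omit [NumberField L] [IsCMField L] in
/-- … and with `inr` the second-copy embedding `(i, v) ↦ (e₂ (inr i), v)`. [folklore] -/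
private theorem sumProdDistrib_symm_trans_inr (k : Fin n × {v : InfinitePlace (Fp L) // v.IsReal}) :
    ((Equiv.sumProdDistrib (Fin n) (Fin n) {v : InfinitePlace (Fp L) // v.IsReal}).symm.trans
        ((e₂ (n := n)).prodCongr (Equiv.refl {v : InfinitePlace (Fp L) // v.IsReal}))) (Sum.inr k) =
      ((e₂ (n := n)) (Sum.inr k.1), k.2) := by
  obtain ⟨i, v⟩ := k
  simp only [Equiv.trans_apply, Equiv.sumProdDistrib_symm_apply_right, Equiv.prodCongr_apply, Prod.map_apply,
    Equiv.coe_refl, id_eq]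

omit [IsCMField L] in
/-- **THE FOCK SYMBOL OF THE JUXTAPOSED INDEX FACTORS OVER THE TWO COPIES**: `ζ_γ = ζ_{β₁} ∘ (first copy) · ζ_{β₂} ∘ (second copy)` in
`ℂ[z_{(n+n) × places}]`, `γ = ((β₁ ⊔ β₂) ∘ sumProdDistrib) ∘ (e₂ × 1)⁻¹` (★ `monomial_sumIdx`, ★ `hcoef_sumIdx`, ★ `hcoef_equivMapDomain`).
[cite: Folland1989, §1.7 (1.81)] -/
theorem zeta_doubledIdx (β₁ β₂ : (Fin n × {v : InfinitePlace (Fp L) // v.IsReal}) →₀ ℕ) :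
    zeta ((((sumIdx β₁ β₂).equivMapDomain
          (Equiv.sumProdDistrib (Fin n) (Fin n) {v : InfinitePlace (Fp L) // v.IsReal}).symm).equivMapDomain
        ((e₂ (n := n)).prodCongr (Equiv.refl {v : InfinitePlace (Fp L) // v.IsReal})))) =
      rename (fun k : Fin n × {v : InfinitePlace (Fp L) // v.IsReal} => ((e₂ (n := n)) (Sum.inl k.1), k.2)) (zeta β₁) *
        rename (fun k : Fin n × {v : InfinitePlace (Fp L) // v.IsReal} => ((e₂ (n := n)) (Sum.inr k.1), k.2)) (zeta β₂) := by
  have hρ₁ : (fun k : Fin n × {v : InfinitePlace (Fp L) // v.IsReal} => ((e₂ (n := n)) (Sum.inl k.1), k.2)) =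
      ⇑((Equiv.sumProdDistrib (Fin n) (Fin n) {v : InfinitePlace (Fp L) // v.IsReal}).symm.trans
        ((e₂ (n := n)).prodCongr (Equiv.refl _))) ∘ Sum.inl :=
    funext fun k => (sumProdDistrib_symm_trans_inl L k).symm
  have hρ₂ : (fun k : Fin n × {v : InfinitePlace (Fp L) // v.IsReal} => ((e₂ (n := n)) (Sum.inr k.1), k.2)) =
      ⇑((Equiv.sumProdDistrib (Fin n) (Fin n) {v : InfinitePlace (Fp L) // v.IsReal}).symm.trans
        ((e₂ (n := n)).prodCongr (Equiv.refl _))) ∘ Sum.inr :=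
    funext fun k => (sumProdDistrib_symm_trans_inr L k).symm
  rw [zeta, zeta, zeta, hcoef_equivMapDomain, hcoef_equivMapDomain, hcoef_sumIdx, Complex.ofReal_mul, map_smul, map_smul,
    smul_mul_smul_comm, ← Finsupp.equivMapDomain_trans, Finsupp.equivMapDomain_eq_mapDomain, ← rename_monomial, monomial_sumIdx,
    map_mul, rename_rename, rename_rename, hρ₁, hρ₂]

/-! ## §3 The doubled frame on the first-copy Fock vectors `B⁻¹P` (the linear span of §1) -/

omit [IsCMField L] in
/-- additivity of `archBoxTensor` in the first slot. [folklore] -/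
private theorem archBoxTensor_add_left {ι₁ ι₂ : Type} [Fintype ι₁] [Fintype ι₂]
    (f f' : 𝓢((ι₁ → mixedSpace (Fp L)), ℂ)) (g : 𝓢((ι₂ → mixedSpace (Fp L)), ℂ)) :
    archBoxTensor (f + f') g = archBoxTensor f g + archBoxTensor f' g := by
  ext x
  simp only [archBoxTensor_apply, add_apply, add_mul]

omit [IsCMField L] in
/-- homogeneity of `archBoxTensor` in the first slot. [folklore] -/
private theorem archBoxTensor_smul_left {ι₁ ι₂ : Type} [Fintype ι₁] [Fintype ι₂] (c : ℂ)
    (f : 𝓢((ι₁ → mixedSpace (Fp L)), ℂ)) (g : 𝓢((ι₂ → mixedSpace (Fp L)), ℂ)) :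
    archBoxTensor (c • f) g = c • archBoxTensor f g := by
  ext x
  simp only [archBoxTensor_apply, _root_.smul_apply, smul_eq_mul, mul_assoc]

/-- **THE DOUBLED FRAME ON `B⁻¹P ⊠ h^V_{β₂}`** for EVERY first-copy Fock polynomial `P` (the linear span of §1 in the first slot):
`frameD^* (R_{e₂}((frameV^*)⁻¹(B⁻¹P) ⊠ h^V_{β₂})) = B⁻¹(P ∘ (first copy) · ζ_{β₂} ∘ (second copy))` (★ `MvPolynomial.induction_on'`:
monomials are multiples of `ζ_α`, where it is §1 + §2). [cite: Folland1989, §1.7 (1.81)] [cite: HarrisKudlaSweet1996, §1 (1.9)] -/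
theorem schwartzTransport_frameD_archBoxTensor_binvPi
    (P : MvPolynomial (Fin n × {v : InfinitePlace (Fp L) // v.IsReal}) ℂ)
    (β₂ : (Fin n × {v : InfinitePlace (Fp L) // v.IsReal}) →₀ ℕ) :
    schwartzTransport (frameD L e dV hdV hdV0 dW hdW hdW0)
        (schwartzReindexCLM (Fp L) (e₂ (n := n))
          (archBoxTensor ((schwartzTransport (frameV L e dV hdV hdV0 dW hdW hdW0)).symm (binvPi P))
            (follandHermite (frameV L e dV hdV hdV0 dW hdW hdW0) β₂))) =
      binvPi (rename (fun k : Fin n × {v : InfinitePlace (Fp L) // v.IsReal} => ((e₂ (n := n)) (Sum.inl k.1), k.2)) P *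
        rename (fun k : Fin n × {v : InfinitePlace (Fp L) // v.IsReal} => ((e₂ (n := n)) (Sum.inr k.1), k.2)) (zeta β₂)) := by
  induction P using MvPolynomial.induction_on' with
  | monomial u a =>
    -- `monomial u a = (a · c_u⁻¹) • ζ_u`, then §1 + §2
    have hmon : (monomial u a : MvPolynomial (Fin n × {v : InfinitePlace (Fp L) // v.IsReal}) ℂ) =
        (a * ((hcoef u : ℝ) : ℂ)⁻¹) • zeta u := by
      rw [mul_smul, ← monomial_one_eq_smul_zeta, smul_monomial, smul_eq_mul, mul_one]
    rw [hmon, binvPi_smul, map_smul, archBoxTensor_smul_left, map_smul, map_smul, map_smul, smul_mul_assoc, binvPi_smul,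
      binvPi_zeta, ← zeta_doubledIdx, binvPi_zeta]
    exact congrArg _ (schwartzTransport_frameD_archBoxTensor_follandHermite L e dV hdV hdV0 dW hdW hdW0 u β₂)
  | add p q hp hq =>
    rw [binvPi_add, map_add, archBoxTensor_add_left, map_add, map_add, hp, hq, map_add, add_mul, binvPi_add]

/-! ## §4 The block `(W ⊕ 1)^{e₂}` at the place `v₀` acts on the first copy by `W`, on the second by `1` -/

omit [NumberField L] [IsCMField L] in
/-- **first copy**: the Bargmann substitution of `((W ⊕ 1)^{e₂} at v₀)⁻¹` composed with the first-copy embedding is the first-copy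
embedding composed with the substitution of `(W at v₀)⁻¹` (entries of `fromBlocks W 0 0 1`: ★ `coe_blockU`, ★ `reindexUnitary_apply`).
[cite: Folland1989, Prop (4.39)] -/
theorem placeMap_linSubst_doubled_comp_rename_inl (W : Matrix.unitaryGroup (Fin n) ℂ)
    (v₀ : {v : InfinitePlace (Fp L) // v.IsReal}) :
    (placeMap v₀ (linSubst (star ((reindexUnitary (e₂ (n := n)).symm (blockU (W, 1)) : Matrix.unitaryGroup (Fin (n + n)) ℂ) :
        Matrix (Fin (n + n)) (Fin (n + n)) ℂ)))).comp
        (rename (fun k : Fin n × {v : InfinitePlace (Fp L) // v.IsReal} => ((e₂ (n := n)) (Sum.inl k.1), k.2))) =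
      (rename (fun k : Fin n × {v : InfinitePlace (Fp L) // v.IsReal} => ((e₂ (n := n)) (Sum.inl k.1), k.2))).comp
        (placeMap v₀ (linSubst (star (W : Matrix (Fin n) (Fin n) ℂ)))) := by
  refine MvPolynomial.algHom_ext fun k => ?_
  obtain ⟨i, v⟩ := k
  rw [AlgHom.comp_apply, AlgHom.comp_apply, rename_X, placeMap_X, placeMap_X]
  by_cases hv : v = v₀
  · subst hv
    rw [if_pos rfl, if_pos rfl, linSubst_X, linSubst_X, map_sum, map_sum, map_sum,
      ← (e₂ (n := n)).sum_comp, Fintype.sum_sum_type]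
    have h2 : ∀ j : Fin n,
        rename (atPlace v) (C (star ((reindexUnitary (e₂ (n := n)).symm (blockU (W, 1)) : Matrix.unitaryGroup (Fin (n + n)) ℂ) :
            Matrix (Fin (n + n)) (Fin (n + n)) ℂ) ((e₂ (n := n)) (Sum.inl i)) ((e₂ (n := n)) (Sum.inr j))) *
          X ((e₂ (n := n)) (Sum.inr j))) = 0 := by
      intro j
      rw [Matrix.star_apply, reindexUnitary_apply, Equiv.symm_apply_apply, Equiv.symm_apply_apply, coe_blockU,
        Matrix.fromBlocks_apply₂₁, Matrix.zero_apply, star_zero, C_0, zero_mul, map_zero]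
    have h1 : ∀ j : Fin n,
        rename (atPlace v) (C (star ((reindexUnitary (e₂ (n := n)).symm (blockU (W, 1)) : Matrix.unitaryGroup (Fin (n + n)) ℂ) :
            Matrix (Fin (n + n)) (Fin (n + n)) ℂ) ((e₂ (n := n)) (Sum.inl i)) ((e₂ (n := n)) (Sum.inl j))) *
          X ((e₂ (n := n)) (Sum.inl j))) =
        rename (fun k : Fin n × {v : InfinitePlace (Fp L) // v.IsReal} => ((e₂ (n := n)) (Sum.inl k.1), k.2))
          (rename (atPlace v) (C ((star (W : Matrix (Fin n) (Fin n) ℂ)) i j) * X j)) := by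
      intro j
      rw [Matrix.star_apply, reindexUnitary_apply, Equiv.symm_apply_apply, Equiv.symm_apply_apply, coe_blockU,
        Matrix.fromBlocks_apply₁₁, Matrix.star_apply, map_mul, map_mul, map_mul, rename_C, rename_C, rename_C, rename_X,
        rename_X, rename_X]
    simp only [h1, h2, Finset.sum_const_zero, add_zero]
  · rw [if_neg hv, if_neg hv, rename_X]

omit [NumberField L] [IsCMField L] in
/-- **second copy**: the substitution of `((W ⊕ 1)^{e₂} at v₀)⁻¹` fixes the second-copy embedding. [cite: Folland1989, Prop (4.39)] -/
theorem placeMap_linSubst_doubled_comp_rename_inr (W : Matrix.unitaryGroup (Fin n) ℂ)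
    (v₀ : {v : InfinitePlace (Fp L) // v.IsReal}) :
    (placeMap v₀ (linSubst (star ((reindexUnitary (e₂ (n := n)).symm (blockU (W, 1)) : Matrix.unitaryGroup (Fin (n + n)) ℂ) :
        Matrix (Fin (n + n)) (Fin (n + n)) ℂ)))).comp
        (rename (fun k : Fin n × {v : InfinitePlace (Fp L) // v.IsReal} => ((e₂ (n := n)) (Sum.inr k.1), k.2))) =
      rename (fun k : Fin n × {v : InfinitePlace (Fp L) // v.IsReal} => ((e₂ (n := n)) (Sum.inr k.1), k.2)) := by
  refine MvPolynomial.algHom_ext fun k => ?_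
  obtain ⟨i, v⟩ := k
  rw [AlgHom.comp_apply, rename_X, placeMap_X]
  by_cases hv : v = v₀
  · subst hv
    rw [if_pos rfl, linSubst_X, map_sum, ← (e₂ (n := n)).sum_comp, Fintype.sum_sum_type]
    have h1 : ∀ j : Fin n,
        rename (atPlace v) (C (star ((reindexUnitary (e₂ (n := n)).symm (blockU (W, 1)) : Matrix.unitaryGroup (Fin (n + n)) ℂ) :
            Matrix (Fin (n + n)) (Fin (n + n)) ℂ) ((e₂ (n := n)) (Sum.inr i)) ((e₂ (n := n)) (Sum.inl j))) *
          X ((e₂ (n := n)) (Sum.inl j))) = 0 := by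
      intro j
      rw [Matrix.star_apply, reindexUnitary_apply, Equiv.symm_apply_apply, Equiv.symm_apply_apply, coe_blockU,
        Matrix.fromBlocks_apply₁₂, Matrix.zero_apply, star_zero, C_0, zero_mul, map_zero]
    have h2 : ∀ j : Fin n,
        rename (atPlace v) (C (star ((reindexUnitary (e₂ (n := n)).symm (blockU (W, 1)) : Matrix.unitaryGroup (Fin (n + n)) ℂ) :
            Matrix (Fin (n + n)) (Fin (n + n)) ℂ) ((e₂ (n := n)) (Sum.inr i)) ((e₂ (n := n)) (Sum.inr j))) *
          X ((e₂ (n := n)) (Sum.inr j))) =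
        if j = i then X (((e₂ (n := n)) (Sum.inr i)), v) else 0 := by
      intro j
      rw [Matrix.star_apply, reindexUnitary_apply, Equiv.symm_apply_apply, Equiv.symm_apply_apply, coe_blockU,
        Matrix.fromBlocks_apply₂₂, OneMemClass.coe_one, Matrix.one_apply]
      by_cases hji : j = i
      · subst hji
        rw [if_pos rfl, star_one, C_1, one_mul, rename_X, if_pos rfl]
      · rw [if_neg hji, star_zero, C_0, zero_mul, map_zero, if_neg hji]
    simp only [h1, h2, Finset.sum_const_zero, zero_add, Finset.sum_ite_eq', Finset.mem_univ, if_true]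
  · rw [if_neg hv]

/-! ## §5 The operator transport: `μ₀((W ⊕ 1)^{e₂} at v₀)` on the doubled Hermite functions -/

/-- **THE DOUBLED METAPLECTIC OPERATOR AT ONE PLACE ON THE HERMITE BASIS**: for every `W ∈ U(n)`, every real place `v₀` and all
multi-indices `β₁, β₂` of one copy,
`μ₀((W ⊕ 1)^{e₂} at v₀) (frameD^* R_{e₂}(h^V_{β₁} ⊠ h^V_{β₂})) = frameD^* R_{e₂}((frameV^*)⁻¹(μ₀(W at v₀) h_{β₁}) ⊠ h^V_{β₂})` — the unitary block
`W ⊕ 1` of the doubled space at the place `v₀` acts on the first copy through `W` and trivially on the second (§1–§4 + ★ `unitaryOpPi_binvPi`,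
★ `linSubst_blockDiagonal_mulSingle`). [cite: Folland1989, Prop (4.39)] [cite: HarrisKudlaSweet1996, §1 (1.9)] -/
theorem unitaryOpPi_placeBlock_mulSingle_doubled_schwartzTransport_frameD (W : Matrix.unitaryGroup (Fin n) ℂ)
    (v₀ : {v : InfinitePlace (Fp L) // v.IsReal}) (β₁ β₂ : (Fin n × {v : InfinitePlace (Fp L) // v.IsReal}) →₀ ℕ) :
    unitaryOpPi (placeBlock (Pi.mulSingle v₀ (reindexUnitary (e₂ (n := n)).symm (blockU (W, 1)))))
        (schwartzTransport (frameD L e dV hdV hdV0 dW hdW hdW0)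
          (schwartzReindexCLM (Fp L) (e₂ (n := n))
            (archBoxTensor (follandHermite (frameV L e dV hdV hdV0 dW hdW hdW0) β₁)
              (follandHermite (frameV L e dV hdV hdV0 dW hdW hdW0) β₂)))) =
      schwartzTransport (frameD L e dV hdV hdV0 dW hdW hdW0)
        (schwartzReindexCLM (Fp L) (e₂ (n := n))
          (archBoxTensor
            ((schwartzTransport (frameV L e dV hdV hdV0 dW hdW hdW0)).symm
              (unitaryOpPi (placeBlock (Pi.mulSingle v₀ W)) (hermitePi β₁)))
            (follandHermite (frameV L e dV hdV hdV0 dW hdW hdW0) β₂))) := by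
  rw [schwartzTransport_frameD_archBoxTensor_follandHermite, ← binvPi_zeta, unitaryOpPi_binvPi, star_coe_placeBlock_mulSingle,
    linSubst_blockDiagonal_mulSingle, zeta_doubledIdx, map_mul, ← AlgHom.comp_apply, placeMap_linSubst_doubled_comp_rename_inl,
    AlgHom.comp_apply, ← AlgHom.comp_apply (placeMap v₀ _), placeMap_linSubst_doubled_comp_rename_inr,
    ← schwartzTransport_frameD_archBoxTensor_binvPi, ← binvPi_zeta, unitaryOpPi_binvPi, star_coe_placeBlock_mulSingle,
    linSubst_blockDiagonal_mulSingle]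

/-- **`hS`-form** (the shape ★ T2 `pairRep_chiSplittingLine_adelicSingle_tmul_of_box` consumes, with β-I's `W`): on `R_{e₂}(h^V_{β₁} ⊠ h^V_{β₂})`,
`carrierConjEquiv frameD (μ₀((W ⊕ 1)^{e₂} at v₀))` is `R_{e₂}(carrierConjEquiv frameV (μ₀(W at v₀)) h^V_{β₁} ⊠ h^V_{β₂})`.
[cite: Folland1989, §4.2 (4.23), Prop (4.39)] [cite: HarrisKudlaSweet1996, §1 (1.9)] -/
theorem carrierConjEquiv_frameD_placeBlock_mulSingle_doubled_archBoxTensor (W : Matrix.unitaryGroup (Fin n) ℂ)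
    (v₀ : {v : InfinitePlace (Fp L) // v.IsReal}) (β₁ β₂ : (Fin n × {v : InfinitePlace (Fp L) // v.IsReal}) →₀ ℕ) :
    carrierConjEquiv (frameD L e dV hdV hdV0 dW hdW hdW0)
        (unitaryEquivPi (placeBlock (Pi.mulSingle v₀ (reindexUnitary (e₂ (n := n)).symm (blockU (W, 1))))))
        (schwartzReindexCLM (Fp L) (e₂ (n := n))
          (archBoxTensor (follandHermite (frameV L e dV hdV hdV0 dW hdW hdW0) β₁)
            (follandHermite (frameV L e dV hdV hdV0 dW hdW hdW0) β₂))) =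
      schwartzReindexCLM (Fp L) (e₂ (n := n))
        (archBoxTensor
          (carrierConjEquiv (frameV L e dV hdV hdV0 dW hdW hdW0) (unitaryEquivPi (placeBlock (Pi.mulSingle v₀ W)))
            (follandHermite (frameV L e dV hdV hdV0 dW hdW hdW0) β₁))
          (follandHermite (frameV L e dV hdV hdV0 dW hdW hdW0) β₂)) := by
  rw [carrierConjEquiv_apply, carrierConjEquiv_apply, unitaryEquivPi_apply, unitaryEquivPi_apply,
    unitaryOpPi_placeBlock_mulSingle_doubled_schwartzTransport_frameD, ContinuousLinearEquiv.symm_apply_apply,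
    schwartzTransport_follandHermite]

end Literature.NumberTheory.GelbartRogawski1991.GRConstruction

end
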